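import Summits.BirchSwinnertonDyer.BirchSwinnertonDyer.Theorems.KolyvaginDepthDoorDepthTableRowKitSecondSign
import Summits.BirchSwinnertonDyer.BirchSwinnertonDyer.Theorems.KolyvaginDepthDoorDepthTableGlobalMinimal
import Summits.BirchSwinnertonDyer.BirchSwinnertonDyer.Theorems.KolyvaginDepthDoorDepthTableOddPrimeKit
import Summits.BirchSwinnertonDyer.BirchSwinnertonDyer.Theorems.Rank2ObservatoryKernelPrimes
import Summits.BirchSwinnertonDyer.BirchSwinnertonDyer.Theorems.Rank1ResidualIntModelReduction
import Summits.BirchSwinnertonDyer.Rank1Residual.Additive.PointCountEulerNat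
import Literature.NumberTheory.EllipticCurves.ComplexMultiplicationNotSemistable
import Literature.NumberTheory.EllipticCurves.RationalPointInfiniteOrderCriteria
import Mathlib.Tactic.NormNum.LegendreSymbol
import HarnessLib

/-!
# Route `KolyvaginDepthDoor` — DEPTH-TABLE ROWS ON THE SECOND SIGN, part 4: `58a1` `(5, -71, 139)`, `58a1` `(5, -167, 139)`
# (crux `KolyvaginDepthSupply`, stmt-BirchSwinnertonDyer-21765)

Helper file (`--supports stmt-BirchSwinnertonDyer-21765 --as helper`); it closes nothing and BSD is
not proved by it.

The route's depth table (g2–g9) has rows only on the crux's FIRST rank clause (`ν + 1 = rank E(ℚ)`,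
the 18 rank-2 and 9 rank-3 Cremona curves). This file fills rows on the SECOND clause
`ν = rank E(ℚ) = rank E^{(d_K)}(ℚ) − 1` with `ν = 1`: a RANK-ONE curve `E` and a Heegner field
`K = ℚ(√D)` for `N_E` whose quadratic twist `E^{(D)}` — a RANK-TWO elliptic curve over `ℚ` of conductor
`N_E·D²`, out of reach of every first-sign row through `K` (no Heegner hypothesis for `N_E D²`) — has
two independent rational points. Everything except the bit is decided in the kernel: `E` globally
minimal, non-CM (a multiplicative prime), `ρ̄_{E,p^m}` onto for all `m` (Mazur 6.3 witness + Serre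
Prop. 21 + a transvection), `p` good ordinary, the Heegner condition for `(Δ(E₀), D)`, the Kolyvagin
prime `ℓ` (`(D/ℓ) = −1`, `p ∣ ℓ + 1`, `p ∣ a_ℓ`), `1 ≤ rank_ℤ E(ℚ)` (a rational point with a denominator,
AEC VII.3.4) and `2 ≤ rank_ℤ E^{(D)}(ℚ)` (the tree's rational kernel certificate
`Rank2Observatory.two_le_mordellWeilRank_of_ratCert` on the twist model `[0, D b₂, 0, 8D²b₄, 16D³b₆]`
of the kit `…RowKitSecondSign`: two points found by a naive search, their chord, an odd torsion
annihilator from kernel point counts, doubling witnesses). Each row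
`SecondSign.C<label>.depthRow_<p>_neg<|D|>_<ℓ>_secondSign` takes ANY frame `(Dt, β, ι)` and ANY single
Kolyvagin–Heegner datum `d` of conductor `ℓ`, the ONE named input (γ) =
`GrossLMS1991.prop37_2_frobeniusCongruence` (Gross 1991 Prop. 3.7 (2); cite-only), and concludes from the
bit `d.kolyvaginClass _ 1 ≠ 0`: `corank_{ℤ_p} Ш(E)[p^∞] = 0`, `rank_ℤ E(ℚ) = 1`,
`corank_{ℤ_p} Ш(E^{(D)})[p^∞] = 0`, `rank_ℤ E^{(D)}(ℚ) = 2`, `E(ℚ)[p] = 0`, `Ш(E/ℚ)[p] = 0`,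
`#Sel^(p)(E/ℚ) = p`, `Ш(E^{(D)}/ℚ)[p] = 0`, `#Sel^(p)(E^{(D)}/ℚ) = p²`. CONDITIONAL on (γ) and the bit;
per-curve; BSD is not proved by it.

| curve | `Δ` | `p` (`a_p`) | `d_K` | `ℓ` (`a_ℓ`) | twist model | `P₁`, `P₂` on the twist model |
|---|---|---|---|---|---|---|
| `58a1` = `[1,-1,0,-1,1]` | `-116` | `5` (`-3`) | `-71` | `139` (`0`) | `[0,213,0,-80656,-22906304]` | `(1136, -40328)`, `(1125279, -1193799538)` |
| `58a1` = `[1,-1,0,-1,1]` | `-116` | `5` (`-3`) | `-167` | `139` (`0`) | `[0,501,0,-446224,-298077632]` | `(41416, -8478256)`, `(31396/25, -5466244/125)` |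

References: [Kolyvagin1991MathAnn] Thm. 2.3; [GrossLMS1991] Prop. 3.7 (2), §5 (5.1), Prop. 6.2 (1);
[McCallumLMS1991] §§2–5; [Serre1972] §5.4 Prop. 21; [Mazur1978] §6 Prop. 6.3 (1);
[CremonaAlgorithms1997] Table 1, §2.4, §3.5; [SilvermanAEC2009] III.2.3, VII.3.1(b), VII.3.4, VIII.6.7,
X.5 Cor. 5.4; [Marcus1977] Ch. 3 Thm. 25; [JetchevLauterStein2009] §3.6 (arXiv:0707.0032).
-/

set_option linter.dupNamespace false

noncomputable section

open scoped Classical NumberField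

namespace Summit.BirchSwinnertonDyer.BirchSwinnertonDyer.Theorems.KolyvaginDepthDoor

open Literature.NumberTheory.EllipticCurves Literature.NumberTheory.EllipticCurves.ModularForms
  WeierstrassCurve
open Summit.BirchSwinnertonDyer.BirchSwinnertonDyer.Rank2Observatory
open Summit.BirchSwinnertonDyer.BirchSwinnertonDyer.Rank1Residual
open Summit.BirchSwinnertonDyer.Rank1Residual.Additive

namespace SecondSign

/-! ## Curve `58a1` = `[1,-1,0,-1,1]` (`Δ = -116`), rank one -/

namespace C58a1

/-- `58a1` = `[1,-1,0,-1,1]` is an elliptic curve over `ℚ` (`Δ = -116 ≠ 0`, kernel-checked).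
[cite: CremonaAlgorithms1997, Table 1 (58a1)] -/
theorem isElliptic : ((⟨1, -1, 0, -1, 1⟩ : WeierstrassCurve ℤ).map (Int.castRingHom ℚ)).IsElliptic := by
  rw [WeierstrassCurve.isElliptic_iff, WeierstrassCurve.map_Δ, isUnit_iff_ne_zero, eq_intCast,
    Int.cast_ne_zero]
  decide +kernel

/-- **`58a1` = `[1,-1,0,-1,1]` is a global minimal equation over `ℚ`** (`|Δ| = 116 < 3¹²`, `2¹² ∤ Δ`;
`isGloballyMinimal_map_int_of_natAbs_Δ_lt`, kernel-checked). [cite: CremonaAlgorithms1997, Table 1 (58a1)]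
[cite: SilvermanAEC2009, VII.1 Remark 1.1 and VIII.8] -/
theorem isGloballyMinimal : ((⟨1, -1, 0, -1, 1⟩ : WeierstrassCurve ℤ).map (Int.castRingHom ℚ)).IsGloballyMinimal :=
  isGloballyMinimal_map_int_of_natAbs_Δ_lt _ (by decide +kernel) (by decide +kernel) (by decide +kernel)

/-- The integral model of `58a1` is `[1,-1,0,-1,1]`. [cite: CremonaAlgorithms1997, Table 1 (58a1)] -/
theorem intModel :
    haveI := isGloballyMinimal;
    integralModelInt ((⟨1, -1, 0, -1, 1⟩ : WeierstrassCurve ℤ).map (Int.castRingHom ℚ)) = ⟨1, -1, 0, -1, 1⟩ := by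
  haveI := isGloballyMinimal
  exact IntModel.integralModelInt_eq_of_map_eq _ rfl

/-- `#Ẽ(𝔽_3) = 7`, `a_3 = -3` for `58a1`, kernel-decided (`ℕ`-arithmetic Euler count
`PointCountNat.natCard_point_map_eq`). [cite: CremonaAlgorithms1997, Table 1 (58a1) and §2.4] -/
theorem card_3 :
    Nat.card (((⟨1, -1, 0, -1, 1⟩ : WeierstrassCurve ℤ).map (Int.castRingHom (ZMod 3))).toAffine.Point) = 7 := by
  rw [PointCountNat.natCard_point_map_eq (hℓ := ⟨by norm_num⟩) (by norm_num) 1 (-1) 0 (-1) 1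
    (by decide +kernel)]
  decide +kernel

/-- `#Ẽ(𝔽_5) = 9`, `a_5 = -3` for `58a1`, kernel-decided (`ℕ`-arithmetic Euler count
`PointCountNat.natCard_point_map_eq`). [cite: CremonaAlgorithms1997, Table 1 (58a1) and §2.4] -/
theorem card_5 :
    Nat.card (((⟨1, -1, 0, -1, 1⟩ : WeierstrassCurve ℤ).map (Int.castRingHom (ZMod 5))).toAffine.Point) = 9 := by
  rw [PointCountNat.natCard_point_map_eq (hℓ := ⟨by norm_num⟩) (by norm_num) 1 (-1) 0 (-1) 1
    (by decide +kernel)]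
  decide +kernel

/-- `#Ẽ(𝔽_139) = 140`, `a_139 = 0` for `58a1`, kernel-decided (`ℕ`-arithmetic Euler count
`PointCountNat.natCard_point_map_eq`). [cite: CremonaAlgorithms1997, Table 1 (58a1) and §2.4] -/
theorem card_139 :
    Nat.card (((⟨1, -1, 0, -1, 1⟩ : WeierstrassCurve ℤ).map (Int.castRingHom (ZMod 139))).toAffine.Point) = 140 := by
  rw [PointCountNat.natCard_point_map_eq (hℓ := ⟨by norm_num⟩) (by norm_num) 1 (-1) 0 (-1) 1
    (by decide +kernel)]
  decide +kernel

/-- **`5 ∈ B(58a1)`: `ρ̄_{E,5^m}` is onto for every `m`** (unconditional): semistable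
(`gcd(c₄, Δ) = 1`), `X² − a_3 X + 3` with `a_3 = -3` root-free mod `5` (`E[5]` irreducible, Mazur
6.3; onto, Serre Prop. 21), and the multiplicative prime `29` with `29^1 ∥ Δ`, `5 ∤ 1` (a transvection
lifts the image to `GL₂(ℤ/5^m)`; `hasSurjectiveModNGaloisRep_pow_of_intModel_certificate`).
[cite: Serre1972, §5.4 Prop. 21] [cite: Mazur1978, §6 Prop. 6.3 (1)] [cite: SerreAbelianLadic1968, Ch. IV §3.4] -/
theorem hasSurjectiveModNGaloisRep_pow_5 (m : ℕ) :
    ((⟨1, -1, 0, -1, 1⟩ : WeierstrassCurve ℤ).map (Int.castRingHom ℚ)).HasSurjectiveModNGaloisRep (5 ^ m : ℕ) := by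
  have hn : ∀ t : ZMod 5, t ^ 2 - (((3 : ℕ) : ℤ) + 1 - (7 : ℕ) : ℤ) * t + ((3 : ℕ) : ZMod 5) ≠ 0 := by
    decide +kernel
  haveI := Fact.mk (by norm_num : Nat.Prime 5)
  haveI := Fact.mk (by norm_num : Nat.Prime 3)
  haveI := isElliptic
  haveI := isGloballyMinimal
  exact hasSurjectiveModNGaloisRep_pow_of_intModel_certificate intModel
    (by rw [Int.isCoprime_iff_gcd_eq_one]; decide +kernel) 5 3 (by norm_num) (by decide +kernel)
    (n := 7) card_3 hn 29 (by norm_num) (by norm_num) (by decide +kernel) (by decide +kernel)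
    (e := 1) (by decide +kernel) (by decide +kernel) (by decide +kernel) m

/-- **`5` is a prime of good ordinary reduction for `58a1`** (`5 ∤ Δ`, `a_5 = -3`) — the crux's
conditions on the witness prime. [cite: CremonaAlgorithms1997, Table 1 (58a1)] -/
theorem goodOrdinary_5 :
    haveI := Fact.mk (by norm_num : Nat.Prime 5);
    haveI := isGloballyMinimal;
    ((⟨1, -1, 0, -1, 1⟩ : WeierstrassCurve ℤ).map (Int.castRingHom ℚ)).HasGoodReductionAtPrime 5 ∧ ¬ ((5 : ℕ) : ℤ) ∣ ((⟨1, -1, 0, -1, 1⟩ : WeierstrassCurve ℤ).map (Int.castRingHom ℚ)).frobeniusTrace 5 := by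
  haveI := Fact.mk (by norm_num : Nat.Prime 5)
  haveI := isGloballyMinimal
  exact goodOrdinary_of_intModel_certificate intModel 5 (by decide +kernel) (n := 9) card_5
    (by decide +kernel)

/-- **`58a1` is not CM** (unconditional): multiplicative reduction at `29` (`29 ∣ Δ = -116`,
`29 ∤ c₄ = 57`), while a CM curve over `ℚ` has no multiplicative prime (integral `j`).
[cite: SilvermanATAEC1994, Thm. II.6.4 (PDF p. 148)] [cite: CremonaAlgorithms1997, Table 1 (58a1)] -/
theorem not_hasCM :
    haveI := isElliptic;
    ¬ ((⟨1, -1, 0, -1, 1⟩ : WeierstrassCurve ℤ).map (Int.castRingHom ℚ)).HasCM := by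
  haveI := isElliptic
  haveI := isGloballyMinimal
  haveI := Fact.mk (by norm_num : Nat.Prime 29)
  intro hCM
  exact not_hasMultiplicativeReductionAtPrime_of_hasCM _ hCM 29
    (IntModel.hasMultiplicativeReductionAtPrime_of_intModel intModel 29 (by decide +kernel)
      (by decide +kernel))

/-- **`1 ≤ rank_ℤ E(ℚ)` for `58a1` IN THE KERNEL** — kind-`NL` certificate: the rational point
`4·(-1, 0) = (50959/12769, 7182400/1442897)` has `113 ∣ den(x)`, hence infinite order (AEC VII.3.4; tree
`one_le_mordellWeilRank_of_dvd_den`). [cite: SilvermanAEC2009, VII.3.4 and Thm. VIII.6.7]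
[cite: CremonaAlgorithms1997, Table 1 (58a1)] -/
theorem one_le_rank : 1 ≤ ((⟨1, -1, 0, -1, 1⟩ : WeierstrassCurve ℤ).map (Int.castRingHom ℚ)).mordellWeilRank := by
  haveI := isElliptic
  haveI := isGloballyMinimal
  haveI : Fact (Nat.Prime 113) := ⟨by norm_num⟩
  have hP : ((⟨1, -1, 0, -1, 1⟩ : WeierstrassCurve ℤ).map (Int.castRingHom ℚ)).toAffine.Nonsingular ((50959 : ℚ) / 12769) ((7182400 : ℚ) / 1442897) :=
    WeierstrassCurve.Affine.equation_iff_nonsingular.mp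
      ((WeierstrassCurve.Affine.equation_iff _ _).mpr (by norm_num [WeierstrassCurve.map]))
  exact one_le_mordellWeilRank_of_dvd_den _ 113 (by norm_num) hP (by decide +kernel)


/-! ### Row `58a1`, `(p, d_K, ℓ) = (5, -71, 139)`: the twist `E^{(-71)}` has rank two -/

/-- **Heegner data `d_K = -71` for `58a1`**: every prime of `Δ = -116` (hence of `N_E`) splits in a
quadratic field of discriminant `-71` (Kronecker symbols `= 1`). [cite: Marcus1977, Ch. 3 Thm. 25]
[cite: GrossLMS1991, §1] -/
theorem heegner_neg71 : ∀ q : ℕ, q.Prime → (q : ℤ) ∣ (⟨1, -1, 0, -1, 1⟩ : WeierstrassCurve ℤ).Δ →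
    (q = 2 → (-71 : ℤ) % 8 = 1) ∧ (q ≠ 2 → jacobiSym (-71) q = 1) :=
  forall_prime_dvd_of_natAbs_eq_pow_mul_pow (a := 2) (i := 2) (b := 29) (j := 1) (by decide +kernel)
    (by norm_num) (by norm_num) ⟨by norm_num, by norm_num⟩ ⟨by norm_num, by norm_num⟩

/-- The twist model of the kit `…RowKitSecondSign` for `(58a1, D = -71)`:
`[0, D b₂, 0, 8 D² b₄, 16 D³ b₆] = ⟨0, 213, 0, -80656, -22906304⟩` (`ℚ`-isomorphic to `E^{(-71)}`, `u = 1/2`).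
[cite: SilvermanAEC2009, X.5 Cor. 5.4] -/
theorem twistModel_neg71 :
    (⟨0, (-71) * (⟨1, -1, 0, -1, 1⟩ : WeierstrassCurve ℤ).b₂, 0, 8 * (-71) ^ 2 * (⟨1, -1, 0, -1, 1⟩ : WeierstrassCurve ℤ).b₄, 16 * (-71) ^ 3 * (⟨1, -1, 0, -1, 1⟩ : WeierstrassCurve ℤ).b₆⟩ : WeierstrassCurve ℤ) =
      ⟨0, 213, 0, -80656, -22906304⟩ := by
  ext <;> decide +kernel

/-- Killers for the twist model `⟨0, 213, 0, -80656, -22906304⟩` of `E^{(-71)}` from the kernel counts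
`(q, #Ṽ(𝔽_q)) ∈ [(3, 7), (11, 11)]`. [cite: SilvermanAEC2009, Prop. VII.3.1(b)] -/
theorem killers_neg71 : ∀ ℓN ∈ [((3 : ℕ), (7 : ℕ)), (11, 11)], ℓN.1.Prime ∧
    ∀ (x : ((⟨0, 213, 0, -80656, -22906304⟩ : WeierstrassCurve ℤ).map (Int.castRingHom ℚ)).toAffine.Point)
      (n : ℕ), ¬ ℓN.1 ∣ n → n • x = 0 → ℓN.2 • x = 0 :=
  killers_cons _ (q := 3) (N := 7) (by decide +kernel) (by decide +kernel)
    (killers_cons _ (q := 11) (N := 11) (by decide +kernel) (by decide +kernel)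
    (killers_nil _))

/-- **`2 ≤ rank_ℤ E^{(-71)}(ℚ)` for `E = 58a1` IN THE KERNEL**, on the twist model `⟨0, 213, 0, -80656, -22906304⟩`: rational
kernel certificate `Rank2Observatory.two_le_mordellWeilRank_of_ratCert` with the points
`P₁ = (1136, -40328)`, `P₂ = (1125279, -1193799538)` (found by a naive search on `d·η² = f(x)`), their chord
`P₁ + P₂ = (52892288/49729, -405261841384/11089567)`, odd torsion annihilator `t = 1` from the counts at `q = 3, 11`, and doubling
witnesses at `q = 17, 7, 7` (residues `(14,13)`, `(1,6)`, `(1,1)`). Hence `P₁, P₂` are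
`ℤ`-independent. [cite: SilvermanAEC2009, III.2.3, Prop. VII.3.1(b) and Thm. VIII.6.7]
[cite: CremonaAlgorithms1997, §3.5] -/
theorem two_le_rank_twist_neg71 :
    2 ≤ ((⟨0, 213, 0, -80656, -22906304⟩ : WeierstrassCurve ℤ).map (Int.castRingHom ℚ)).mordellWeilRank :=
  two_le_mordellWeilRank_of_ratCert _ (x₁ := 1136) (y₁ := -40328) (x₂ := 1125279) (y₂ := -1193799538)
    (x₃ := 52892288/49729) (y₃ := -405261841384/11089567) (by decide +kernel) (by decide +kernel)
    (by decide +kernel) (by decide +kernel) (t := 1) (by decide) killers_neg71 (by decide +kernel)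
    17 7 7 (by decide +kernel) (by decide +kernel) (by decide +kernel) (by decide +kernel)
    (by decide +kernel) (by decide +kernel) 14 13 1 6 1 1 (by decide +kernel)
    (by decide +kernel) (by decide +kernel) (by decide +kernel) (by decide +kernel)
    (by decide +kernel)

/-- **SECOND-SIGN DEPTH-TABLE ROW `58a1`, `(p, d_K, ℓ) = (5, -71, 139)`, ON PRINT-STANDARD INPUTS.**
For `E = 58a1` (rank one), ANY imaginary quadratic `K` with `d_K = -71` (Heegner for `N_E`; the twist
`E^{(-71)}` has two independent rational points, certified in the kernel), any frame `(Dt, β, ι)` and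
ANY single Kolyvagin–Heegner datum `d` of conductor `139` (a Kolyvagin prime: `(-71/139) = −1`,
`5 ∣ 139 + 1`, `5 ∣ a_139 = 0`), granted the ONE Literature fact (γ) =
`GrossLMS1991.prop37_2_frobeniusCongruence` (Gross 1991 Prop. 3.7 (2); cite-only): IF
`d.kolyvaginClass _ 1 ≠ 0` (the row's bit), THEN `corank_{ℤ_5} Ш(E)[5^∞] = 0`, `rank_ℤ E(ℚ) = 1`,
`corank_{ℤ_5} Ш(E^{(-71)})[5^∞] = 0`, `rank_ℤ E^{(-71)}(ℚ) = 2`, `E(ℚ)[5] = 0`, `Ш(E/ℚ)[5] = 0`,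
`#Sel^(5)(E/ℚ) = 5`, `Ш(E^{(-71)}/ℚ)[5] = 0` and `#Sel^(5)(E^{(-71)}/ℚ) = 5²` — the crux's SECOND
rank clause `ν = rank E(ℚ) = rank E^{(d_K)}(ℚ) − 1` at this curve, and `Ш[5] = 0` for the RANK-TWO
curve `E^{(-71)}` (conductor `N_E·71²`), which no first-sign row reaches through `K`. Side conditions:
`ρ̄_{E,5^m}` onto (`hasSurjectiveModNGaloisRep_pow_5`), non-CM, Heegner, Kolyvagin prime
(`card_139`), (KN_5) from `Δ(E₀) = -116` (`decide`-able table), `1 ≤ rank` (`one_le_rank`),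
`2 ≤ rank E^{(-71)}` (`two_le_rank_twist_neg71`) — all kernel theorems. CONDITIONAL on (γ) and the
bit; per-curve; BSD is not proved by it. [cite: Kolyvagin1991MathAnn, Thm. 2.3]
[cite: GrossLMS1991, Prop. 3.7 (2), §5 (5.1), Prop. 6.2 (1)] [cite: McCallumLMS1991, §§2–5]
[cite: JetchevLauterStein2009, §3.6 (arXiv:0707.0032)] -/
theorem depthRow_5_neg71_139_secondSign
    (h372 : GrossLMS1991.prop37_2_frobeniusCongruence)
    (K : Type) [Field K] [NumberField K] (hK : IsImaginaryQuadratic K)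
    (hD : NumberField.discr K = -71) :
    haveI := isElliptic;
    haveI := isGloballyMinimal;
    haveI : NeZero (((⟨1, -1, 0, -1, 1⟩ : WeierstrassCurve ℤ).map (Int.castRingHom ℚ)).conductorNorm ℤ) := neZero_conductorNorm_of_isElliptic _;
    ∀ (Dt : ModularParametrizationData ((⟨1, -1, 0, -1, 1⟩ : WeierstrassCurve ℤ).map (Int.castRingHom ℚ)) (((⟨1, -1, 0, -1, 1⟩ : WeierstrassCurve ℤ).map (Int.castRingHom ℚ)).conductorNorm ℤ)) (β : ℤ) (ι : K →+* ℂ)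
      (d : KolyvaginHeegnerData Dt β ι 139),
    d.kolyvaginClass (p := 5) (by norm_num) 1 ≠ 0 →
    ((⟨1, -1, 0, -1, 1⟩ : WeierstrassCurve ℤ).map (Int.castRingHom ℚ)).shaCorank 5 = 0 ∧ ((⟨1, -1, 0, -1, 1⟩ : WeierstrassCurve ℤ).map (Int.castRingHom ℚ)).mordellWeilRank = 1 ∧
      (((⟨1, -1, 0, -1, 1⟩ : WeierstrassCurve ℤ).map (Int.castRingHom ℚ)).quadraticTwist ((-71 : ℤ) : ℚ)).shaCorank 5 = 0 ∧
      (((⟨1, -1, 0, -1, 1⟩ : WeierstrassCurve ℤ).map (Int.castRingHom ℚ)).quadraticTwist ((-71 : ℤ) : ℚ)).mordellWeilRank = 2 ∧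
      (∀ P : ((⟨1, -1, 0, -1, 1⟩ : WeierstrassCurve ℤ).map (Int.castRingHom ℚ)).toAffine.Point, 5 • P = 0 → P = 0) ∧
      (∀ x ∈ ((⟨1, -1, 0, -1, 1⟩ : WeierstrassCurve ℤ).map (Int.castRingHom ℚ)).sha, 5 • x = 0 → x = 0) ∧
      Nat.card ↥(selmerGroup ((⟨1, -1, 0, -1, 1⟩ : WeierstrassCurve ℤ).map (Int.castRingHom ℚ)) ((5 : ℕ) : ℤ)) = 5 ∧
      (∀ x ∈ (((⟨1, -1, 0, -1, 1⟩ : WeierstrassCurve ℤ).map (Int.castRingHom ℚ)).quadraticTwist ((-71 : ℤ) : ℚ)).sha, 5 • x = 0 → x = 0) ∧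
      Nat.card ↥(selmerGroup (((⟨1, -1, 0, -1, 1⟩ : WeierstrassCurve ℤ).map (Int.castRingHom ℚ)).quadraticTwist ((-71 : ℤ) : ℚ)) ((5 : ℕ) : ℤ)) = 5 ^ 2 := by
  haveI := isElliptic
  haveI := isGloballyMinimal
  haveI : NeZero (((⟨1, -1, 0, -1, 1⟩ : WeierstrassCurve ℤ).map (Int.castRingHom ℚ)).conductorNorm ℤ) := neZero_conductorNorm_of_isElliptic _
  intro Dt β ι d hne
  haveI := Fact.mk (by norm_num : Nat.Prime 5)
  exact depthRowSecondSign_print_of_datum_of_intModel_certificate intModel h372 not_hasCM one_le_rank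
    5 (by norm_num) hasSurjectiveModNGaloisRep_pow_5 K hK hD (by norm_num) (by norm_num)
    twistModel_neg71 two_le_rank_twist_neg71 heegner_neg71 139 (by norm_num) (by norm_num)
    (by decide +kernel) (by norm_num) (by norm_num) (by norm_num) (by norm_num) (n := 140) card_139
    (by norm_num) (Δ₀ := -116) (by decide +kernel) (B := 11) (by decide +kernel) (by decide +kernel)
    (fun _ _ ↦ Or.inl (by norm_num)) Dt β ι d hne


/-! ### Row `58a1`, `(p, d_K, ℓ) = (5, -167, 139)`: the twist `E^{(-167)}` has rank two -/

/-- **Heegner data `d_K = -167` for `58a1`**: every prime of `Δ = -116` (hence of `N_E`) splits in a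
quadratic field of discriminant `-167` (Kronecker symbols `= 1`). [cite: Marcus1977, Ch. 3 Thm. 25]
[cite: GrossLMS1991, §1] -/
theorem heegner_neg167 : ∀ q : ℕ, q.Prime → (q : ℤ) ∣ (⟨1, -1, 0, -1, 1⟩ : WeierstrassCurve ℤ).Δ →
    (q = 2 → (-167 : ℤ) % 8 = 1) ∧ (q ≠ 2 → jacobiSym (-167) q = 1) :=
  forall_prime_dvd_of_natAbs_eq_pow_mul_pow (a := 2) (i := 2) (b := 29) (j := 1) (by decide +kernel)
    (by norm_num) (by norm_num) ⟨by norm_num, by norm_num⟩ ⟨by norm_num, by norm_num⟩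

/-- The twist model of the kit `…RowKitSecondSign` for `(58a1, D = -167)`:
`[0, D b₂, 0, 8 D² b₄, 16 D³ b₆] = ⟨0, 501, 0, -446224, -298077632⟩` (`ℚ`-isomorphic to `E^{(-167)}`, `u = 1/2`).
[cite: SilvermanAEC2009, X.5 Cor. 5.4] -/
theorem twistModel_neg167 :
    (⟨0, (-167) * (⟨1, -1, 0, -1, 1⟩ : WeierstrassCurve ℤ).b₂, 0, 8 * (-167) ^ 2 * (⟨1, -1, 0, -1, 1⟩ : WeierstrassCurve ℤ).b₄, 16 * (-167) ^ 3 * (⟨1, -1, 0, -1, 1⟩ : WeierstrassCurve ℤ).b₆⟩ : WeierstrassCurve ℤ) =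
      ⟨0, 501, 0, -446224, -298077632⟩ := by
  ext <;> decide +kernel

/-- Killers for the twist model `⟨0, 501, 0, -446224, -298077632⟩` of `E^{(-167)}` from the kernel counts
`(q, #Ṽ(𝔽_q)) ∈ [(3, 7), (11, 13)]`. [cite: SilvermanAEC2009, Prop. VII.3.1(b)] -/
theorem killers_neg167 : ∀ ℓN ∈ [((3 : ℕ), (7 : ℕ)), (11, 13)], ℓN.1.Prime ∧
    ∀ (x : ((⟨0, 501, 0, -446224, -298077632⟩ : WeierstrassCurve ℤ).map (Int.castRingHom ℚ)).toAffine.Point)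
      (n : ℕ), ¬ ℓN.1 ∣ n → n • x = 0 → ℓN.2 • x = 0 :=
  killers_cons _ (q := 3) (N := 7) (by decide +kernel) (by decide +kernel)
    (killers_cons _ (q := 11) (N := 13) (by decide +kernel) (by decide +kernel)
    (killers_nil _))

/-- **`2 ≤ rank_ℤ E^{(-167)}(ℚ)` for `E = 58a1` IN THE KERNEL**, on the twist model `⟨0, 501, 0, -446224, -298077632⟩`: rational
kernel certificate `Rank2Observatory.two_le_mordellWeilRank_of_ratCert` with the points
`P₁ = (41416, -8478256)`, `P₂ = (31396/25, -5466244/125)` (found by a naive search on `d·η² = f(x)`), their chord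
`P₁ + P₂ = (75856/81, -17014744/729)`, odd torsion annihilator `t = 1` from the counts at `q = 3, 11`, and doubling
witnesses at `q = 17, 7, 7` (residues `(4,1)`, `(2,0)`, `(1,2)`). Hence `P₁, P₂` are
`ℤ`-independent. [cite: SilvermanAEC2009, III.2.3, Prop. VII.3.1(b) and Thm. VIII.6.7]
[cite: CremonaAlgorithms1997, §3.5] -/
theorem two_le_rank_twist_neg167 :
    2 ≤ ((⟨0, 501, 0, -446224, -298077632⟩ : WeierstrassCurve ℤ).map (Int.castRingHom ℚ)).mordellWeilRank :=
  two_le_mordellWeilRank_of_ratCert _ (x₁ := 41416) (y₁ := -8478256) (x₂ := 31396/25) (y₂ := -5466244/125)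
    (x₃ := 75856/81) (y₃ := -17014744/729) (by decide +kernel) (by decide +kernel)
    (by decide +kernel) (by decide +kernel) (t := 1) (by decide) killers_neg167 (by decide +kernel)
    17 7 7 (by decide +kernel) (by decide +kernel) (by decide +kernel) (by decide +kernel)
    (by decide +kernel) (by decide +kernel) 4 1 2 0 1 2 (by decide +kernel)
    (by decide +kernel) (by decide +kernel) (by decide +kernel) (by decide +kernel)
    (by decide +kernel)

/-- **SECOND-SIGN DEPTH-TABLE ROW `58a1`, `(p, d_K, ℓ) = (5, -167, 139)`, ON PRINT-STANDARD INPUTS.**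
For `E = 58a1` (rank one), ANY imaginary quadratic `K` with `d_K = -167` (Heegner for `N_E`; the twist
`E^{(-167)}` has two independent rational points, certified in the kernel), any frame `(Dt, β, ι)` and
ANY single Kolyvagin–Heegner datum `d` of conductor `139` (a Kolyvagin prime: `(-167/139) = −1`,
`5 ∣ 139 + 1`, `5 ∣ a_139 = 0`), granted the ONE Literature fact (γ) =
`GrossLMS1991.prop37_2_frobeniusCongruence` (Gross 1991 Prop. 3.7 (2); cite-only): IF
`d.kolyvaginClass _ 1 ≠ 0` (the row's bit), THEN `corank_{ℤ_5} Ш(E)[5^∞] = 0`, `rank_ℤ E(ℚ) = 1`,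
`corank_{ℤ_5} Ш(E^{(-167)})[5^∞] = 0`, `rank_ℤ E^{(-167)}(ℚ) = 2`, `E(ℚ)[5] = 0`, `Ш(E/ℚ)[5] = 0`,
`#Sel^(5)(E/ℚ) = 5`, `Ш(E^{(-167)}/ℚ)[5] = 0` and `#Sel^(5)(E^{(-167)}/ℚ) = 5²` — the crux's SECOND
rank clause `ν = rank E(ℚ) = rank E^{(d_K)}(ℚ) − 1` at this curve, and `Ш[5] = 0` for the RANK-TWO
curve `E^{(-167)}` (conductor `N_E·167²`), which no first-sign row reaches through `K`. Side conditions: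
`ρ̄_{E,5^m}` onto (`hasSurjectiveModNGaloisRep_pow_5`), non-CM, Heegner, Kolyvagin prime
(`card_139`), (KN_5) from `Δ(E₀) = -116` (`decide`-able table), `1 ≤ rank` (`one_le_rank`),
`2 ≤ rank E^{(-167)}` (`two_le_rank_twist_neg167`) — all kernel theorems. CONDITIONAL on (γ) and the
bit; per-curve; BSD is not proved by it. [cite: Kolyvagin1991MathAnn, Thm. 2.3]
[cite: GrossLMS1991, Prop. 3.7 (2), §5 (5.1), Prop. 6.2 (1)] [cite: McCallumLMS1991, §§2–5]
[cite: JetchevLauterStein2009, §3.6 (arXiv:0707.0032)] -/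
theorem depthRow_5_neg167_139_secondSign
    (h372 : GrossLMS1991.prop37_2_frobeniusCongruence)
    (K : Type) [Field K] [NumberField K] (hK : IsImaginaryQuadratic K)
    (hD : NumberField.discr K = -167) :
    haveI := isElliptic;
    haveI := isGloballyMinimal;
    haveI : NeZero (((⟨1, -1, 0, -1, 1⟩ : WeierstrassCurve ℤ).map (Int.castRingHom ℚ)).conductorNorm ℤ) := neZero_conductorNorm_of_isElliptic _;
    ∀ (Dt : ModularParametrizationData ((⟨1, -1, 0, -1, 1⟩ : WeierstrassCurve ℤ).map (Int.castRingHom ℚ)) (((⟨1, -1, 0, -1, 1⟩ : WeierstrassCurve ℤ).map (Int.castRingHom ℚ)).conductorNorm ℤ)) (β : ℤ) (ι : K →+* ℂ)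
      (d : KolyvaginHeegnerData Dt β ι 139),
    d.kolyvaginClass (p := 5) (by norm_num) 1 ≠ 0 →
    ((⟨1, -1, 0, -1, 1⟩ : WeierstrassCurve ℤ).map (Int.castRingHom ℚ)).shaCorank 5 = 0 ∧ ((⟨1, -1, 0, -1, 1⟩ : WeierstrassCurve ℤ).map (Int.castRingHom ℚ)).mordellWeilRank = 1 ∧
      (((⟨1, -1, 0, -1, 1⟩ : WeierstrassCurve ℤ).map (Int.castRingHom ℚ)).quadraticTwist ((-167 : ℤ) : ℚ)).shaCorank 5 = 0 ∧
      (((⟨1, -1, 0, -1, 1⟩ : WeierstrassCurve ℤ).map (Int.castRingHom ℚ)).quadraticTwist ((-167 : ℤ) : ℚ)).mordellWeilRank = 2 ∧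
      (∀ P : ((⟨1, -1, 0, -1, 1⟩ : WeierstrassCurve ℤ).map (Int.castRingHom ℚ)).toAffine.Point, 5 • P = 0 → P = 0) ∧
      (∀ x ∈ ((⟨1, -1, 0, -1, 1⟩ : WeierstrassCurve ℤ).map (Int.castRingHom ℚ)).sha, 5 • x = 0 → x = 0) ∧
      Nat.card ↥(selmerGroup ((⟨1, -1, 0, -1, 1⟩ : WeierstrassCurve ℤ).map (Int.castRingHom ℚ)) ((5 : ℕ) : ℤ)) = 5 ∧
      (∀ x ∈ (((⟨1, -1, 0, -1, 1⟩ : WeierstrassCurve ℤ).map (Int.castRingHom ℚ)).quadraticTwist ((-167 : ℤ) : ℚ)).sha, 5 • x = 0 → x = 0) ∧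
      Nat.card ↥(selmerGroup (((⟨1, -1, 0, -1, 1⟩ : WeierstrassCurve ℤ).map (Int.castRingHom ℚ)).quadraticTwist ((-167 : ℤ) : ℚ)) ((5 : ℕ) : ℤ)) = 5 ^ 2 := by
  haveI := isElliptic
  haveI := isGloballyMinimal
  haveI : NeZero (((⟨1, -1, 0, -1, 1⟩ : WeierstrassCurve ℤ).map (Int.castRingHom ℚ)).conductorNorm ℤ) := neZero_conductorNorm_of_isElliptic _
  intro Dt β ι d hne
  haveI := Fact.mk (by norm_num : Nat.Prime 5)
  exact depthRowSecondSign_print_of_datum_of_intModel_certificate intModel h372 not_hasCM one_le_rank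
    5 (by norm_num) hasSurjectiveModNGaloisRep_pow_5 K hK hD (by norm_num) (by norm_num)
    twistModel_neg167 two_le_rank_twist_neg167 heegner_neg167 139 (by norm_num) (by norm_num)
    (by decide +kernel) (by norm_num) (by norm_num) (by norm_num) (by norm_num) (n := 140) card_139
    (by norm_num) (Δ₀ := -116) (by decide +kernel) (B := 11) (by decide +kernel) (by decide +kernel)
    (fun _ _ ↦ Or.inl (by norm_num)) Dt β ι d hne

end C58a1


end SecondSign

end Summit.BirchSwinnertonDyer.BirchSwinnertonDyer.Theorems.KolyvaginDepthDoor

end
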